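import Mathlib.Data.List.Basic
import Mathlib.Data.List.Perm.Basic
import Literature.Computability.Cryptography.SequenceProblems
import HarnessLib

/-!
# Longest common subsequence: the combinatorial toolkit of Bringmann–Künnemann, §4

Facts about `lcsLength` (`Literature.Computability.Cryptography.SequenceProblems`) and the number
of unmatched symbols `dLCS x y := |x| + |y| - 2·|LCS(x,y)|` (K. Bringmann, M. Künnemann,
*Quadratic conditional lower bounds for string problems and dynamic time warping*, FOCS 2015,
arXiv:1502.01063, §4: "we instead consider the number of unmatched symbols
`δ_LCS(x,y) := |x| + |y| - 2|LCS(x,y)|`"), needed for the alignment gadget of BK15 §4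
(`Literature.Computability.FineGrained.LCSGadget`):

* `lcsLength` is the maximal length of a common sublist (`lcsLength_spec`,
  `List.Sublist.length_le_lcsLength`, `exists_common_sublist`); symmetry, invariance under
  reversal, monotonicity under `List.Sublist`, common prefixes/suffixes
  (`lcsLength_append_same_left/right`), LCS against a constant string
  (`lcsLength_replicate_right`);
* BK15 **Lemma 4.4** (ordered partitions), binary form: `exists_split_lcsLength_append_right`
  (`|LCS(x, y₁y₂)| = |LCS(x₁,y₁)| + |LCS(x₂,y₂)|` for some split `x = x₁x₂`) and superadditivity
  `lcsLength_append_append_le`;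
* `dLCS` and its bookkeeping (`dLCS_add`), the counting lower bounds
  `length_sub_length_le_dLCS`, `count_sub_count_le_dLCS`, and `dLCS_replicate_right`;
* BK15 **Lemma 4.5**: (1) `dLCS_append_same_left` (`δ(1^k z, 1^k w) = δ(z, w)`), (2)
  `min_le_dLCS_replicate_append` (`δ(0^ℓ z, 1^k w) ≥ min{k, δ(z, 1^k w)}`) and its symmetric /
  reversed forms.

Everything is proved for lists over a type with decidable equality.
-/

namespace Literature.Computability.Cryptography

variable {α : Type*} [DecidableEq α]

open List

/-! ### `lcsLength` is the length of a longest common sublist -/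

/-- **`lcsLength x y` is the maximal length of a common sublist of `x` and `y`**: every common
sublist has length `≤ lcsLength x y`, and some common sublist attains it (Wagner–Fischer 1974, §5;
BK15 §4, "a longest common subsequence is a string that appears in `x` and in `y` as a
subsequence and has maximal length"). [cite: BringmannKunnemannFOCS2015, §4 (definition of LCS)] -/
theorem lcsLength_spec : ∀ (x y : List α),
    (∀ s : List α, s <+ x → s <+ y → s.length ≤ lcsLength x y) ∧
    (∃ s : List α, s <+ x ∧ s <+ y ∧ s.length = lcsLength x y)
  | [], y => ⟨fun s hs _ => by simp [List.sublist_nil.1 hs],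
      [], List.nil_sublist _, List.nil_sublist _, by simp⟩
  | a :: xs, [] => ⟨fun s _ hs => by simp [List.sublist_nil.1 hs],
      [], List.nil_sublist _, List.nil_sublist _, by simp⟩
  | a :: xs, b :: ys => by
      obtain ⟨ih₁, s₁, hs₁x, hs₁y, hs₁⟩ := lcsLength_spec xs ys
      obtain ⟨ih₂, s₂, hs₂x, hs₂y, hs₂⟩ := lcsLength_spec xs (b :: ys)
      obtain ⟨ih₃, s₃, hs₃x, hs₃y, hs₃⟩ := lcsLength_spec (a :: xs) ys
      rw [lcsLength_cons_cons]
      by_cases hab : a = b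
      · subst hab
        rw [if_pos rfl]
        refine ⟨fun s hsx hsy => ?_, a :: s₁, hs₁x.cons_cons a, hs₁y.cons_cons a, by simp [hs₁]⟩
        rcases List.sublist_cons_iff.1 hsx with hsx' | ⟨r, rfl, hr⟩
        · rcases List.sublist_cons_iff.1 hsy with hsy' | ⟨r', rfl, hr'⟩
          · exact (ih₁ s hsx' hsy').trans (Nat.le_succ _)
          · have hr'x : r' <+ xs := (List.sublist_cons_self a r').trans hsx'
            simpa using ih₁ r' hr'x hr'
        · rcases List.sublist_cons_iff.1 hsy with hsy' | ⟨r', hrr', hr'⟩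
          · have hry : r <+ ys := (List.sublist_cons_self a r).trans hsy'
            simpa using ih₁ r hr hry
          · obtain ⟨-, rfl⟩ := List.cons.inj hrr'
            simpa using ih₁ r hr hr'
      · rw [if_neg hab]
        refine ⟨fun s hsx hsy => ?_, ?_⟩
        · rcases List.sublist_cons_iff.1 hsx with hsx' | ⟨r, rfl, hr⟩
          · exact (ih₂ s hsx' hsy).trans (le_max_left _ _)
          · rcases List.sublist_cons_iff.1 hsy with hsy' | ⟨r', hrr', -⟩
            · exact (ih₃ _ hsx hsy').trans (le_max_right _ _)
            · exact absurd (List.cons.inj hrr').1 hab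
        · rcases le_total (lcsLength xs (b :: ys)) (lcsLength (a :: xs) ys) with h | h
          · rw [max_eq_right h]; exact ⟨s₃, hs₃x, hs₃y.cons b, hs₃⟩
          · rw [max_eq_left h]; exact ⟨s₂, hs₂x.cons a, hs₂y, hs₂⟩
termination_by x y => x.length + y.length

/-- A common sublist is no longer than the LCS. [cite: BringmannKunnemannFOCS2015, §4 (definition of LCS)] -/
theorem _root_.List.Sublist.length_le_lcsLength {s x y : List α} (hx : s <+ x) (hy : s <+ y) :
    s.length ≤ lcsLength x y :=
  (lcsLength_spec x y).1 s hx hy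

/-- Some common sublist has length `lcsLength x y`. [cite: BringmannKunnemannFOCS2015, §4 (definition of LCS)] -/
theorem exists_common_sublist (x y : List α) :
    ∃ s : List α, s <+ x ∧ s <+ y ∧ s.length = lcsLength x y :=
  (lcsLength_spec x y).2

/-- LCS is symmetric. [folklore] -/
theorem lcsLength_comm (x y : List α) : lcsLength x y = lcsLength y x := by
  apply le_antisymm
  · obtain ⟨s, hx, hy, hs⟩ := exists_common_sublist x y
    rw [← hs]; exact hy.length_le_lcsLength hx
  · obtain ⟨s, hy, hx, hs⟩ := exists_common_sublist y x
    rw [← hs]; exact hx.length_le_lcsLength hy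

/-- LCS is invariant under reversing both lists. [folklore] -/
theorem lcsLength_reverse (x y : List α) : lcsLength x.reverse y.reverse = lcsLength x y := by
  apply le_antisymm
  · obtain ⟨s, hx, hy, hs⟩ := exists_common_sublist x.reverse y.reverse
    have hx' : s.reverse <+ x := by simpa using hx.reverse
    have hy' : s.reverse <+ y := by simpa using hy.reverse
    rw [← hs, ← List.length_reverse]
    exact hx'.length_le_lcsLength hy'
  · obtain ⟨s, hx, hy, hs⟩ := exists_common_sublist x y
    rw [← hs, ← List.length_reverse]
    exact hx.reverse.length_le_lcsLength hy.reverse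

/-- LCS is monotone under sublists in the first argument. [folklore] -/
theorem lcsLength_mono_left {x x' : List α} (h : x <+ x') (y : List α) :
    lcsLength x y ≤ lcsLength x' y := by
  obtain ⟨s, hx, hy, hs⟩ := exists_common_sublist x y
  rw [← hs]; exact (hx.trans h).length_le_lcsLength hy

/-- LCS is monotone under sublists in the second argument. [folklore] -/
theorem lcsLength_mono_right (x : List α) {y y' : List α} (h : y <+ y') :
    lcsLength x y ≤ lcsLength x y' := by
  rw [lcsLength_comm x y, lcsLength_comm x y']; exact lcsLength_mono_left h x

/-- **Superadditivity** (the easy half of BK15 Lemma 4.4): concatenating common sublists,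
`|LCS(x₁,y₁)| + |LCS(x₂,y₂)| ≤ |LCS(x₁x₂, y₁y₂)|`. [cite: BringmannKunnemannFOCS2015, Lemma 4.4] -/
theorem lcsLength_append_append_le (x₁ x₂ y₁ y₂ : List α) :
    lcsLength x₁ y₁ + lcsLength x₂ y₂ ≤ lcsLength (x₁ ++ x₂) (y₁ ++ y₂) := by
  obtain ⟨s₁, hx₁, hy₁, hs₁⟩ := exists_common_sublist x₁ y₁
  obtain ⟨s₂, hx₂, hy₂, hs₂⟩ := exists_common_sublist x₂ y₂
  rw [← hs₁, ← hs₂, ← List.length_append]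
  exact (hx₁.append hx₂).length_le_lcsLength (hy₁.append hy₂)

/-- **BK15 Lemma 4.4 (ordered partitions), binary form**: for every `x, y₁, y₂` there is a split
`x = x₁ x₂` with `|LCS(x, y₁y₂)| = |LCS(x₁,y₁)| + |LCS(x₂,y₂)|` (split a longest common sublist
along `y₁ | y₂` and `x` accordingly). [cite: BringmannKunnemannFOCS2015, Lemma 4.4] -/
theorem exists_split_lcsLength_append_right (x y₁ y₂ : List α) :
    ∃ x₁ x₂ : List α, x₁ ++ x₂ = x ∧
      lcsLength x (y₁ ++ y₂) = lcsLength x₁ y₁ + lcsLength x₂ y₂ := by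
  obtain ⟨s, hx, hy, hs⟩ := exists_common_sublist x (y₁ ++ y₂)
  obtain ⟨s₁, s₂, rfl, hs₁, hs₂⟩ := List.sublist_append_iff.1 hy
  obtain ⟨x₁, x₂, rfl, hx₁, hx₂⟩ := List.append_sublist_iff.1 hx
  refine ⟨x₁, x₂, rfl, le_antisymm ?_ (lcsLength_append_append_le x₁ x₂ y₁ y₂)⟩
  rw [← hs, List.length_append]
  exact Nat.add_le_add (hx₁.length_le_lcsLength hs₁) (hx₂.length_le_lcsLength hs₂)

/-- A common prefix is matched greedily: `|LCS(p x, p y)| = |p| + |LCS(x, y)|` (BK15 Lemma 4.5(1),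
LCS form). [cite: BringmannKunnemannFOCS2015, Lemma 4.5(1)] -/
theorem lcsLength_append_same_left (p x y : List α) :
    lcsLength (p ++ x) (p ++ y) = p.length + lcsLength x y := by
  induction p with
  | nil => simp
  | cons a p ih => simp [lcsLength_cons_cons, ih]; ring

/-- A common suffix is matched greedily: `|LCS(x s, y s)| = |LCS(x, y)| + |s|`.
[cite: BringmannKunnemannFOCS2015, Lemma 4.5(1)] -/
theorem lcsLength_append_same_right (x y s : List α) :
    lcsLength (x ++ s) (y ++ s) = lcsLength x y + s.length := by
  rw [← lcsLength_reverse, List.reverse_append, List.reverse_append, lcsLength_append_same_left,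
    lcsLength_reverse, List.length_reverse, Nat.add_comm]

/-- LCS against a constant string `a^n` is `min{#ₐ x, n}`. [folklore] -/
theorem lcsLength_replicate_right (x : List α) (n : ℕ) (a : α) :
    lcsLength x (List.replicate n a) = min (x.count a) n := by
  apply le_antisymm
  · obtain ⟨s, hx, hy, hs⟩ := exists_common_sublist x (List.replicate n a)
    obtain ⟨m, hm, rfl⟩ := List.sublist_replicate_iff.1 hy
    rw [← hs, List.length_replicate]
    exact le_min (List.replicate_sublist_iff.1 hx) hm
  · have h1 : List.replicate (min (x.count a) n) a <+ x :=
      List.replicate_sublist_iff.2 (min_le_left _ _)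
    have h2 : List.replicate (min (x.count a) n) a <+ List.replicate n a :=
      (List.replicate_sublist_replicate a).2 (min_le_right _ _)
    simpa using h1.length_le_lcsLength h2

omit [DecidableEq α] in
/-- A sublist starting with a symbol different from `b` skips a leading block `b^k`. [folklore] -/
theorem cons_sublist_of_cons_sublist_replicate_append {c b : α} (hcb : c ≠ b) {s w : List α} :
    ∀ {k : ℕ}, c :: s <+ List.replicate k b ++ w → c :: s <+ w
  | 0, h => by simpa using h
  | k + 1, h => by
      rw [List.replicate_succ, List.cons_append] at h
      rcases List.sublist_cons_iff.1 h with h' | ⟨r, hr, -⟩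
      · exact cons_sublist_of_cons_sublist_replicate_append hcb h'
      · exact absurd (List.cons.inj hr).1 hcb

/-! ### The number of unmatched symbols `δ_LCS` -/

/-- **`δ_LCS(x, y) := |x| + |y| - 2 |LCS(x, y)|`**, the number of unmatched symbols
(Bringmann–Künnemann, FOCS 2015, §4; "this is equivalent to `EDIT(1,1,0,2)`").
[cite: BringmannKunnemannFOCS2015, §4 (definition of δ_LCS)] -/
def dLCS (x y : List α) : ℕ := x.length + y.length - 2 * lcsLength x y

/-- `2 |LCS(x,y)| ≤ |x| + |y|`. [folklore] -/
theorem two_mul_lcsLength_le (x y : List α) : 2 * lcsLength x y ≤ x.length + y.length := by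
  have h1 := lcsLength_le_length_left x y
  have h2 := lcsLength_le_length_right x y
  omega

/-- The defining identity of `dLCS` without truncated subtraction:
`δ(x,y) + 2|LCS(x,y)| = |x| + |y|`. [cite: BringmannKunnemannFOCS2015, §4 (definition of δ_LCS)] -/
theorem dLCS_add (x y : List α) : dLCS x y + 2 * lcsLength x y = x.length + y.length := by
  have := two_mul_lcsLength_le x y
  unfold dLCS; omega

/-- `δ_LCS` is symmetric. [folklore] -/
theorem dLCS_comm (x y : List α) : dLCS x y = dLCS y x := by
  unfold dLCS; rw [lcsLength_comm, Nat.add_comm]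

/-- `δ_LCS` is invariant under reversing both strings. [folklore] -/
theorem dLCS_reverse (x y : List α) : dLCS x.reverse y.reverse = dLCS x y := by
  unfold dLCS; rw [lcsLength_reverse, List.length_reverse, List.length_reverse]

/-- `δ_LCS(x, x) = 0`. [folklore] -/
@[simp] theorem dLCS_self (x : List α) : dLCS x x = 0 := by
  unfold dLCS; rw [lcsLength_self]; omega

/-- `δ_LCS(x, y) ≤ |x| + |y|`. [folklore] -/
theorem dLCS_le_add (x y : List α) : dLCS x y ≤ x.length + y.length := by
  unfold dLCS; omega

/-- The length difference is a lower bound: `|x| - |y| ≤ δ_LCS(x, y)`. [folklore] -/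
theorem length_sub_length_le_dLCS (x y : List α) : x.length - y.length ≤ dLCS x y := by
  have := lcsLength_le_length_right x y
  unfold dLCS; omega

/-- The length difference is a lower bound: `|y| - |x| ≤ δ_LCS(x, y)`. [folklore] -/
theorem length_sub_length_le_dLCS' (x y : List α) : y.length - x.length ≤ dLCS x y := by
  rw [dLCS_comm]; exact length_sub_length_le_dLCS y x

/-- Deleting a sublist removes at least as many symbols as occurrences of any letter. [folklore] -/
theorem _root_.List.Sublist.count_sub_count_le_length_sub {s x : List α} (h : s <+ x) (a : α) :
    x.count a - s.count a ≤ x.length - s.length := by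
  obtain ⟨l, hl⟩ := h.exists_perm_append
  have h1 : x.count a = s.count a + l.count a := by rw [hl.count_eq, List.count_append]
  have h2 : x.length = s.length + l.length := by rw [hl.length_eq, List.length_append]
  have h3 : l.count a ≤ l.length := List.count_le_length
  omega

/-- **Counting bound**: the surplus of any letter is unmatched, `#ₐ x - #ₐ y ≤ δ_LCS(x, y)`
(BK15, proof of Claim 4.8: "at most … zeroes of `x(G(yⱼ))` can be matched, leaving at least …
unmatched"). [cite: BringmannKunnemannFOCS2015, Claim 4.8 (proof)] -/
theorem count_sub_count_le_dLCS (x y : List α) (a : α) : x.count a - y.count a ≤ dLCS x y := by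
  obtain ⟨s, hx, hy, hs⟩ := exists_common_sublist x y
  have h1 := hx.count_sub_count_le_length_sub a
  have h2 : s.count a ≤ y.count a := hy.count_le a
  have h3 := hy.length_le
  unfold dLCS; omega

/-- Counting bound, symmetric form: `#ₐ y - #ₐ x ≤ δ_LCS(x, y)`. [cite: BringmannKunnemannFOCS2015, Claim 4.8 (proof)] -/
theorem count_sub_count_le_dLCS' (x y : List α) (a : α) : y.count a - x.count a ≤ dLCS x y := by
  rw [dLCS_comm]; exact count_sub_count_le_dLCS y x a

/-- `δ_LCS` against a constant string: `δ(x, a^n) = |x| + n - 2 min{#ₐ x, n}`.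
[cite: BringmannKunnemannFOCS2015, Lemma 4.6 (proof)] -/
theorem dLCS_replicate_right (x : List α) (n : ℕ) (a : α) :
    dLCS x (List.replicate n a) = x.length + n - 2 * min (x.count a) n := by
  unfold dLCS; rw [lcsLength_replicate_right, List.length_replicate]

/-- Monotonicity bookkeeping: if `x` is a sublist of `x'`, then
`δ(x', y) ≤ δ(x, y) + (|x'| - |x|)`. [folklore] -/
theorem dLCS_le_dLCS_add_of_sublist {x x' : List α} (h : x <+ x') (y : List α) :
    dLCS x' y ≤ dLCS x y + (x'.length - x.length) := by
  have h1 := lcsLength_mono_left h y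
  have h2 := h.length_le
  have h3 := two_mul_lcsLength_le x y
  unfold dLCS; omega

/-! ### BK15 Lemma 4.5: greedy matching of leading blocks -/

/-- **BK15 Lemma 4.5(1)**: a common prefix can be matched greedily, `δ(p z, p w) = δ(z, w)` (in
print for `p = 1^k`). [cite: BringmannKunnemannFOCS2015, Lemma 4.5(1)] -/
theorem dLCS_append_same_left (p z w : List α) : dLCS (p ++ z) (p ++ w) = dLCS z w := by
  unfold dLCS; rw [lcsLength_append_same_left, List.length_append, List.length_append]; omega

/-- BK15 Lemma 4.5(1), suffix form: `δ(z s, w s) = δ(z, w)`. [cite: BringmannKunnemannFOCS2015, Lemma 4.5(1)] -/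
theorem dLCS_append_same_right (z w s : List α) : dLCS (z ++ s) (w ++ s) = dLCS z w := by
  unfold dLCS; rw [lcsLength_append_same_right, List.length_append, List.length_append]; omega

/-- **BK15 Lemma 4.5(2)**: for letters `a ≠ b`, `δ(a^ℓ z, b^k w) ≥ min{k, δ(z, b^k w)}` — a
longest common subsequence either starts inside `w` (leaving `b^k` unmatched) or does not use the
leading `a^ℓ`. [cite: BringmannKunnemannFOCS2015, Lemma 4.5(2)] -/
theorem min_le_dLCS_replicate_append {a b : α} (hab : a ≠ b) (ℓ k : ℕ) (z w : List α) :
    min k (dLCS z (List.replicate k b ++ w)) ≤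
      dLCS (List.replicate ℓ a ++ z) (List.replicate k b ++ w) := by
  obtain ⟨s, hx, hy, hs⟩ := exists_common_sublist (List.replicate ℓ a ++ z)
    (List.replicate k b ++ w)
  have hkey : dLCS (List.replicate ℓ a ++ z) (List.replicate k b ++ w) + 2 * s.length =
      ℓ + z.length + (k + w.length) := by
    have := dLCS_add (List.replicate ℓ a ++ z) (List.replicate k b ++ w)
    simpa [hs] using this
  rcases s with _ | ⟨c, s'⟩
  · -- nothing matched
    refine (min_le_left _ _).trans ?_
    simp only [List.length_nil] at hkey; omega
  · by_cases hca : c = a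
    · -- the LCS starts with `a ≠ b`: it lives inside `w`, so `b^k` is unmatched
      subst hca
      have hw : c :: s' <+ w := cons_sublist_of_cons_sublist_replicate_append hab hy
      have h1 := hw.length_le
      have h2 := hx.length_le
      refine (min_le_left _ _).trans ?_
      simp only [List.length_cons, List.length_append, List.length_replicate] at hkey h1 h2 ⊢
      omega
    · -- the LCS does not touch `a^ℓ`: it is a common subsequence of `z` and `b^k w`
      have hz : c :: s' <+ z := cons_sublist_of_cons_sublist_replicate_append hca hx
      have h1 := hz.length_le_lcsLength hy
      have h2 := dLCS_add z (List.replicate k b ++ w)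
      refine (min_le_right _ _).trans ?_
      simp only [List.length_cons, List.length_append, List.length_replicate] at hkey h1 h2 ⊢
      omega

/-- BK15 Lemma 4.5(2'), the symmetric form: `δ(a^k z, b^ℓ w) ≥ min{k, δ(a^k z, w)}` for `a ≠ b`.
[cite: BringmannKunnemannFOCS2015, Lemma 4.5(2')] -/
theorem min_le_dLCS_replicate_append' {a b : α} (hab : a ≠ b) (k ℓ : ℕ) (z w : List α) :
    min k (dLCS (List.replicate k a ++ z) w) ≤
      dLCS (List.replicate k a ++ z) (List.replicate ℓ b ++ w) := by
  rw [dLCS_comm (List.replicate k a ++ z) w, dLCS_comm (List.replicate k a ++ z)]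
  exact min_le_dLCS_replicate_append (Ne.symm hab) ℓ k w z

/-- BK15 Lemma 4.5(2), reversed form ("we obtain more symmetric statements by reversing all
involved strings"): `δ(z a^ℓ, w b^k) ≥ min{k, δ(z, w b^k)}` for `a ≠ b`.
[cite: BringmannKunnemannFOCS2015, Lemma 4.5 (reversed forms)] -/
theorem min_le_dLCS_append_replicate {a b : α} (hab : a ≠ b) (ℓ k : ℕ) (z w : List α) :
    min k (dLCS z (w ++ List.replicate k b)) ≤
      dLCS (z ++ List.replicate ℓ a) (w ++ List.replicate k b) := by
  have h := min_le_dLCS_replicate_append hab ℓ k z.reverse w.reverse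
  rw [← dLCS_reverse z, ← dLCS_reverse (z ++ _)]
  simpa [List.reverse_append, List.reverse_replicate] using h

/-- BK15 Lemma 4.5(2'), reversed form: `δ(z a^k, w b^ℓ) ≥ min{k, δ(z a^k, w)}` for `a ≠ b`.
[cite: BringmannKunnemannFOCS2015, Lemma 4.5 (reversed forms)] -/
theorem min_le_dLCS_append_replicate' {a b : α} (hab : a ≠ b) (k ℓ : ℕ) (z w : List α) :
    min k (dLCS (z ++ List.replicate k a) w) ≤
      dLCS (z ++ List.replicate k a) (w ++ List.replicate ℓ b) := by
  rw [dLCS_comm (z ++ _) w, dLCS_comm (z ++ _)]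
  exact min_le_dLCS_append_replicate (Ne.symm hab) ℓ k w z

end Literature.Computability.Cryptography
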